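import Mathlib.Algebra.Group.Subgroup.Pointwise
import Mathlib.SetTheory.Cardinal.Finite
import Mathlib.Tactic.Group
import Literature.Computability.AlgebraicComplexity.SubgroupTPPAbelianPrimeIndex
import HarnessLib

/-!
# No two members of a non-trivial subgroup TPP triple permute (Murthy 2026, Prop. 2.6 (1), subgroup form)

Topic `Literature/Computability/AlgebraicComplexity` (group-theoretic matrix multiplication: subgroup
TPP triples, the tree's `DihedralSubgroups.SubgroupTPP` of `CohnUmansDihedralSubgroupTPP.lean`;
companion of `SubgroupTPPQuotient.lean` (Prop. 2.6 (2): no member is normal) and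
`SubgroupTPPAbelianPrimeIndex.lean`).

S. R. Murthy, *On the triple product property for subgroups of finite nilpotent groups of class 2*,
arXiv:2602.15796v1 (2026), p. 5, verbatim:

> **Definition 2.5.** Two non-empty subsets `X, Y` of a group `G` are said to *permute* (in `G`), or,
> equivalently, be *permutable* (in `G`), if `XY = YX`, where `XY = {xy | x ∈ X, y ∈ Y}` and
> `YX = {yx | x ∈ X, y ∈ Y}`.
>
> **Proposition 2.6.** Let `(S, T, U)` be a non-trivial TPP triple of a group `G`, that is, one such
> that `|S||T||U| > |G|`. Then
> (1) No member `S, T, U` permutes with another member and its inverse, that is, for any distinct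
> `X, Y ∈ {S, T, U}` either `XY ≠ YX` or `XY⁻¹ ≠ Y⁻¹X`.
> (2) No member `S, T, U` is normalised by (or, in particular, centralised by) by `G` or by each
> other, that is, `N_G(X) < G` for any `X ∈ {S, T, U}`, and `Y, Z ⊊ N_G(X)` for any distinct
> `X, Y, Z ∈ {S, T, U}`. In particular, if `(S, T, U)` is a subgroup TPP triple then `S, T, U` are all
> non-normal subgroups. […]
> *Proof.* (1) Let `S` permute with `T` and `T⁻¹`. Then `Q(ST) = ST(ST)⁻¹ = STT⁻¹S⁻¹ = TT⁻¹SS⁻¹ =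
> Q(T)Q(S)`, where `Q(T)Q(S) ∩ Q(U) = {1}` (by the TPP for the permuted triple `(T, S, U)`), and so
> by [4, Lemma 3.1] `(ST, U, {1})` is a TPP triple of `G` such that `|S||T||U| ≤ |G|`, a
> contradiction. […] (2) Let `S` be normalised by `G`, that is, `N_G(S) = G`. Then `S` permutes with
> `T` and `T⁻¹`, and by part (1) `|S||T||U| ≤ |G|`, a contradiction. […]

## What is here (all proved; 0 definitions, 0 named facts)

The SUBGROUP case of Prop. 2.6 (1) (for subgroups `Y = Y⁻¹`, so "permutes with `Y` and `Y⁻¹`" is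
just `XY = YX`), in contrapositive form and with the one-sided inclusion that the argument actually
uses:

* `Murthy2026.mul_mul_injective_of_mul_subset` — if `(S, T, U)` is a subgroup TPP triple and
  `TS ⊆ ST` (as subsets of `G`), then `(s, t, u) ↦ s t u` is injective on `S × T × U`;
* `Murthy2026_prop26_1_subgroup'` — hence `|S| |T| |U| ≤ |G|` (finite `G`, hypothesis `TS ⊆ ST`);
* `Murthy2026_prop26_1_subgroup` — **Prop. 2.6 (1), subgroup form**: if the members `S` and `T`
  permute (`ST = TS`) then `|S| |T| |U| ≤ |G|`; `Murthy2026_prop26_1_subgroup_all` — for a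
  non-trivial subgroup TPP triple (`|S||T||U| > |G|`) no two of the three members permute;
* `Murthy2026_prop26_2_normalizer` / `Murthy2026_prop26_2_normalizer'` — the "or by each other"
  clause of **Prop. 2.6 (2)** for subgroups: `T ≤ N_G(S)` (or `S ≤ N_G(T)`) already forces
  `|S| |T| |U| ≤ |G|` (a member normalising another makes the two permute). For subgroup triples this
  clause is also the case `N(H₁) ∩ H₂ = H₂` of Blasiak–Cohn–Grochow–Pratt–Umans 2023, Thm. 3.6 (tree:
  `Literature/Barriers/MatrixMultiplication/NormalizerBarrier.lean`,
  `SubgroupTPP.card_mul_card_normalizer_inf_mul_card_le`); permutability `ST = TS` is strictly weaker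
  than either normalisation (e.g. `S₄ = C₄ · S₃` with neither factor normalising the other), so (1)
  is the sharper pruning rule.

Direct proof (replacing the note's route through `Q(ST) = Q(T)Q(S)` and [4, Lemma 3.1], which is
phrased for subsets): if `s t u = s' t' u'` then `t'⁻¹ s'⁻¹ s ∈ TS ⊆ ST`, say `= s₁ t₁`, and
`s₁ · (t₁ t) · (u u'⁻¹) = t'⁻¹ s'⁻¹ (s t u) u'⁻¹ = 1` is a TPP word, so `u = u'`; then
`(s'⁻¹ s)(t t'⁻¹) · 1 = 1` is a TPP word, so `s = s'`, `t = t'`.  The general SUBSET statement of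
Prop. 2.6 (1) (with both `XY = YX` and `XY⁻¹ = Y⁻¹X`) is not formalised here.

Census reading (pub-omega, family (b)): a search over subgroup triples may discard every pair of
candidate members `(S, T)` with `ST = TS` — in particular every pair in which one member normalises
the other — before any third member is tried.

## References
* S. R. Murthy, arXiv:2602.15796v1 (2026): Def. 2.5 and Prop. 2.6 (1)–(2) with proof (p. 5).
  [Murthy2026]
* J. Blasiak, H. Cohn, J. A. Grochow, K. Pratt, C. Umans, *Matrix multiplication via matrix groups*,
  ITCS 2023, Thm. 3.6 (the normaliser observation `|H₁||N(H₁) ∩ H₂||H₃| ≤ |G|`).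
  [BlasiakCohnGrochowPrattUmans2023]
-/

namespace Literature.Computability.AlgebraicComplexity

open DihedralSubgroups
open scoped Pointwise

variable {G : Type*} [Group G]

namespace Murthy2026

/-- **The triple product map is injective when `TS ⊆ ST`.** For a subgroup TPP triple `(S, T, U)`
with `TS ⊆ ST` (as subsets of `G`), `(s, t, u) ↦ s t u` is injective on `S × T × U`: from
`s t u = s' t' u'` write `t'⁻¹ s'⁻¹ s = s₁ t₁ ∈ ST`; then `s₁ (t₁ t) (u u'⁻¹) = 1` is a TPP word, so
`u = u'`, and `(s'⁻¹ s)(t t'⁻¹) · 1 = 1` is a TPP word, so `s = s'`, `t = t'`.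
[cite: Murthy2026, Prop. 2.6 (1) (proof)] -/
theorem mul_mul_injective_of_mul_subset {S T U : Subgroup G} (h : SubgroupTPP S T U)
    (hTS : (T : Set G) * (S : Set G) ⊆ (S : Set G) * (T : Set G)) :
    Function.Injective (fun x : S × T × U => (x.1 : G) * (x.2.1 : G) * (x.2.2 : G)) := by
  rintro ⟨⟨s, hs⟩, ⟨t, ht⟩, ⟨u, hu⟩⟩ ⟨⟨s', hs'⟩, ⟨t', ht'⟩, ⟨u', hu'⟩⟩ he
  simp only at he
  -- `t'⁻¹ (s'⁻¹ s) ∈ TS ⊆ ST`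
  have hmem : t'⁻¹ * (s'⁻¹ * s) ∈ (S : Set G) * (T : Set G) :=
    hTS (Set.mul_mem_mul (T.inv_mem ht') (S.mul_mem (S.inv_mem hs') hs))
  obtain ⟨s₁, hs₁, t₁, ht₁, e⟩ := Set.mem_mul.1 hmem
  -- the TPP word `s₁ (t₁ t) (u u'⁻¹) = 1`
  have hword : s₁ * (t₁ * t) * (u * u'⁻¹) = 1 := by
    calc s₁ * (t₁ * t) * (u * u'⁻¹) = (s₁ * t₁) * (t * u) * u'⁻¹ := by group
      _ = t'⁻¹ * (s'⁻¹ * s) * (t * u) * u'⁻¹ := by rw [e]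
      _ = t'⁻¹ * s'⁻¹ * (s * t * u) * u'⁻¹ := by group
      _ = t'⁻¹ * s'⁻¹ * (s' * t' * u') * u'⁻¹ := by rw [he]
      _ = 1 := by group
  obtain ⟨-, -, h3⟩ := h s₁ hs₁ (t₁ * t) (T.mul_mem ht₁ ht) (u * u'⁻¹)
    (U.mul_mem hu (U.inv_mem hu')) hword
  have eu : u = u' := mul_inv_eq_one.1 h3
  subst eu
  -- now `s t = s' t'`, and `(s'⁻¹ s)(t t'⁻¹) · 1 = 1` is a TPP word
  have he2 : s * t = s' * t' := mul_right_cancel he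
  have hword2 : s'⁻¹ * s * (t * t'⁻¹) * 1 = 1 := by
    calc s'⁻¹ * s * (t * t'⁻¹) * 1 = s'⁻¹ * (s * t) * t'⁻¹ := by group
      _ = s'⁻¹ * (s' * t') * t'⁻¹ := by rw [he2]
      _ = 1 := by group
  obtain ⟨h1, h2, -⟩ := h (s'⁻¹ * s) (S.mul_mem (S.inv_mem hs') hs) (t * t'⁻¹)
    (T.mul_mem ht (T.inv_mem ht')) 1 U.one_mem hword2
  have es : s' = s := inv_mul_eq_one.1 h1
  have et : t = t' := mul_inv_eq_one.1 h2
  subst es; subst et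
  rfl

end Murthy2026

open Murthy2026

/-- **Murthy 2026, Prop. 2.6 (1), subgroup form, one-sided hypothesis**: if `(S, T, U)` is a subgroup
TPP triple of a finite group and `TS ⊆ ST`, then `|S| |T| |U| ≤ |G|` (the triple is trivial).
[cite: Murthy2026, Prop. 2.6 (1)] -/
theorem Murthy2026_prop26_1_subgroup' [Finite G] {S T U : Subgroup G} (h : SubgroupTPP S T U)
    (hTS : (T : Set G) * (S : Set G) ⊆ (S : Set G) * (T : Set G)) :
    Nat.card S * Nat.card T * Nat.card U ≤ Nat.card G := by
  have hc := Nat.card_le_card_of_injective _ (mul_mul_injective_of_mul_subset h hTS)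
  simpa only [Nat.card_prod, mul_assoc] using hc

/-- **Murthy 2026, Prop. 2.6 (1), subgroup form** ("no member permutes with another member and its
inverse", for subgroups: no two members permute; contrapositive): if the members `S` and `T` of a
subgroup TPP triple of a finite group permute, `ST = TS`, then `|S| |T| |U| ≤ |G|`.
[cite: Murthy2026, Prop. 2.6 (1)] -/
theorem Murthy2026_prop26_1_subgroup [Finite G] {S T U : Subgroup G} (h : SubgroupTPP S T U)
    (hperm : (S : Set G) * (T : Set G) = (T : Set G) * (S : Set G)) :
    Nat.card S * Nat.card T * Nat.card U ≤ Nat.card G :=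
  Murthy2026_prop26_1_subgroup' h hperm.symm.le

/-- **Murthy 2026, Prop. 2.6 (1), subgroup form, all three pairs**: in a non-trivial subgroup TPP
triple (`|S||T||U| > |G|`) of a finite group no two members permute: `ST ≠ TS`, `SU ≠ US`,
`TU ≠ UT`. [cite: Murthy2026, Prop. 2.6 (1)] -/
theorem Murthy2026_prop26_1_subgroup_all [Finite G] {S T U : Subgroup G} (h : SubgroupTPP S T U)
    (hnt : Nat.card G < Nat.card S * Nat.card T * Nat.card U) :
    (S : Set G) * (T : Set G) ≠ (T : Set G) * (S : Set G) ∧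
      (S : Set G) * (U : Set G) ≠ (U : Set G) * (S : Set G) ∧
      (T : Set G) * (U : Set G) ≠ (U : Set G) * (T : Set G) := by
  refine ⟨fun hp => ?_, fun hp => ?_, fun hp => ?_⟩
  · exact absurd (Murthy2026_prop26_1_subgroup h hp) (not_le.2 hnt)
  · -- `(S, U, T)` is a subgroup TPP triple
    have h' := Murthy2026_prop26_1_subgroup (Murthy2025.subgroupTPP_swap h) hp
    exact absurd h' (by rw [mul_right_comm]; exact not_le.2 hnt)
  · -- `(T, U, S)` is a subgroup TPP triple
    have h' := Murthy2026_prop26_1_subgroup (Murthy2025.subgroupTPP_rotate h) hp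
    exact absurd h' (by rw [mul_comm (Nat.card T * Nat.card U) (Nat.card S), ← mul_assoc]; exact not_le.2 hnt)

/-- **Murthy 2026, Prop. 2.6 (2), the "or by each other" clause, subgroup form**: if the member `T`
normalises the member `S` (`T ≤ N_G(S)`), then `S` and `T` permute and `|S| |T| |U| ≤ |G|`. For
subgroup triples this is also the case `N(H₁) ∩ H₂ = H₂` of BCGPU 2023, Thm. 3.6.
[cite: Murthy2026, Prop. 2.6 (2)] [cite: BlasiakCohnGrochowPrattUmans2023, Thm. 3.6] -/
theorem Murthy2026_prop26_2_normalizer [Finite G] {S T U : Subgroup G} (h : SubgroupTPP S T U)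
    (hTN : T ≤ Subgroup.normalizer (S : Set G)) : Nat.card S * Nat.card T * Nat.card U ≤ Nat.card G := by
  refine Murthy2026_prop26_1_subgroup' h ?_
  rintro _ ⟨t, ht, s, hs, rfl⟩
  -- `t s = (t s t⁻¹) t` with `t s t⁻¹ ∈ S`
  have hc : t * s * t⁻¹ ∈ S := ((Subgroup.mem_normalizer_iff.1 (hTN ht)) s).1 hs
  exact ⟨t * s * t⁻¹, hc, t, ht, by group⟩

/-- The same with the roles exchanged: if `S ≤ N_G(T)` then `|S| |T| |U| ≤ |G|`
(`t s = s (s⁻¹ t s)` with `s⁻¹ t s ∈ T`). [cite: Murthy2026, Prop. 2.6 (2)]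
[cite: BlasiakCohnGrochowPrattUmans2023, Thm. 3.6] -/
theorem Murthy2026_prop26_2_normalizer' [Finite G] {S T U : Subgroup G} (h : SubgroupTPP S T U)
    (hSN : S ≤ Subgroup.normalizer (T : Set G)) : Nat.card S * Nat.card T * Nat.card U ≤ Nat.card G := by
  refine Murthy2026_prop26_1_subgroup' h ?_
  rintro _ ⟨t, ht, s, hs, rfl⟩
  have hc : s⁻¹ * t * s⁻¹⁻¹ ∈ T := ((Subgroup.mem_normalizer_iff.1 (hSN (S.inv_mem hs))) t).1 ht
  exact ⟨s, hs, s⁻¹ * t * s⁻¹⁻¹, hc, by group⟩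

end Literature.Computability.AlgebraicComplexity
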